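import Summits.RiemannHypothesis.RiemannHypothesis.Theorems.PfPersistenceFloorNodeless
import Summits.RiemannHypothesis.RiemannHypothesis.Theorems.PfPersistenceWeilParityPair
import HarnessLib

/-!
# PF persistence — the ODD-SECTOR mirror of the floored nodelessness reader (RULING A119 (2)(b); A88 ADD. 2 (δ))
(pub-rhpf barrier-typer gen 6; deprecate-and-add: nothing of `PfPersistenceFloorNodeless` is touched)

**HONEST FRAMING. This is a long-odds MECHANISM SEARCH; no RH claims.** Statements and elementary lemmas only; RH-free.
RULING A119 (2)(b) (adj-3 g20): the even-block floor binder `floorNodelessAt φ win` (21018c8f9c0b) discharges the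
A88 add. 2 (δ) RETURN for the EVEN conjunct of the `eo` cell; the ODD conjunct stays 'DATA at `φ = 1e-20`, untyped'
until the typer lands the odd mirror — "the same two definitions over the odd profile, new names". This file is that
landing, on the cell's `Datum` through cand-6's read-off odd block `oddDatum d win = oddOfEven (d win)`
(`PfPersistenceWeilParityPair`, 023ff2bd28f7; `= oddBlock w win` on weight-table data, `oddDatum_datumOf`).

The observatory's conventions (schema `weilobs.point/1` §0 item 7, §2.4): odd basis
`ξ₋ₙ(x) = (−1)ⁿ (2/L)^{1/2} sin(2π n x / L)`, `n = 1 … N`; odd ground profile `θ₁^odd(x) = Σ_{i<N} u_odd[i] · ξ₋₍ᵢ₊₁₎(x)`;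
ALL shape descriptors (`theta_min/max_odd`, `theta_sign_changes_odd`) are read on the closed HALF-WINDOW
`H = [0, L/2]` — necessarily so: an odd profile is antisymmetric (`profileOdd_neg`), so on the full window it is
one-signed only when it vanishes identically on `H` (`oneSignedOddFull_iff`); the loader's digit-floor rule
(`rhpf_harness/records.py theta_sign_reading`, ATLAS F21) is orientation-free: floored iff the smaller lobe is below
`10^{-20}` of the larger, i.e. `FloorOneSignedOdd L (1e-20)`.

* `xiOdd`, `profileOdd` (+ `profileOdd_zero`, `profileOdd_neg`, `continuous_profileOdd`), `profileOddMax L u = sup_H |θ_u|`;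
* `OneSignedOdd L u` (raw: one sign on `H`), `FloorOneSignedOdd L φ u` (the `φ`-floored reader on `H`);
* `floorOneSignedOdd_zero_iff`, `FloorOneSignedOdd.mono`, `OneSignedOdd.floorOneSignedOdd`, `floorOneSignedOdd_of_one_le`;
* `oddOneSignedAt win`, `floorNodelessOddAt φ win := {d | ∃ u, IsBottomVector (oddDatum d win) u ∧ FloorOneSignedOdd (2a) φ u}`,
  `floorNodelessOddAt_zero`, `oddOneSignedAt_subset_floorNodelessOddAt`, `floorNodelessOddAt_mono`;
* `finitelyDetermined_floorNodelessOddAt`, `finitelyDetermined_oddOneSignedAt` — single-window readers OF THE EVEN DATUM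
  (the odd block is read off `d win`): inside the locality barrier W1 for every `φ`, exactly like the even reader;
* `floorNodelessEOAt φ win := floorNodelessAt φ win ∩ floorNodelessOddAt φ win` — the `eo` cell's two-parity handle,
  finitely determined.

HANDLE OF RECORD for the odd conjunct: `floorNodelessOddAt (1e-20) win` (a row silent on `φ` reads at `φ = 1e-20`,
MEMBERSHIP R19); exact one-signedness theorems are `φ = 0` statements and imply every `φ ≥ 0` reader, never conversely.
-/

set_option linter.dupNamespace false

noncomputable section

open Real Set Matrix Finset

namespace Summit.RiemannHypothesis.RiemannHypothesis.Theorems.PfPersistence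

/-! ## §1 The odd basis and the odd profile on the half-window `H = [0, L/2]` -/

/-- Connes' ODD trigonometric basis on `[-L/2, L/2]`: `ξ₋ₙ(x) = (−1)ⁿ (2/L)^{1/2} sin(2π n x / L)` (`n ≥ 1`;
schema §0 item 7). -/
def xiOdd (L : ℝ) (n : ℕ) (x : ℝ) : ℝ := (-1 : ℝ) ^ n * Real.sqrt (2 / L) * Real.sin (2 * π * n * x / L)

/-- the ODD PROFILE `θ_u(x) = Σ_{i<N} u_i ξ₋₍ᵢ₊₁₎(x)` of an odd-block coefficient vector (schema `theta_*_odd`, `u_odd[i] ↔ ξ₋₍ᵢ₊₁₎`).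
-/
def profileOdd (L : ℝ) {N : ℕ} (u : Fin N → ℝ) (x : ℝ) : ℝ := ∑ j : Fin N, u j * xiOdd L ((j : ℕ) + 1) x

/-- PROVED: `ξ₋ₙ(0) = 0`. [folklore] -/
theorem xiOdd_zero (L : ℝ) (n : ℕ) : xiOdd L n 0 = 0 := by simp [xiOdd]

/-- PROVED: `ξ₋ₙ` is odd in `x`. [folklore] -/
theorem xiOdd_neg (L : ℝ) (n : ℕ) (x : ℝ) : xiOdd L n (-x) = -xiOdd L n x := by
  simp only [xiOdd]
  rw [show 2 * π * (n : ℝ) * -x / L = -(2 * π * n * x / L) by ring, Real.sin_neg]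
  ring

/-- PROVED: the odd profile vanishes at the centre (the forced node at `x = 0`). [folklore] -/
theorem profileOdd_zero (L : ℝ) {N : ℕ} (u : Fin N → ℝ) : profileOdd L u 0 = 0 := by
  simp [profileOdd, xiOdd_zero]

/-- PROVED: the odd profile is ANTISYMMETRIC, `θ_u(−x) = −θ_u(x)` — whence all shape descriptors live on `H = [0, L/2]`. [folklore] -/
theorem profileOdd_neg (L : ℝ) {N : ℕ} (u : Fin N → ℝ) (x : ℝ) : profileOdd L u (-x) = -profileOdd L u x := by
  simp only [profileOdd, xiOdd_neg, mul_neg, Finset.sum_neg_distrib]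

/-- PROVED: the odd profile is continuous. [folklore] -/
theorem continuous_profileOdd (L : ℝ) {N : ℕ} (u : Fin N → ℝ) : Continuous fun x => profileOdd L u x := by
  unfold profileOdd xiOdd; fun_prop

/-- `max_H |θ_u|` on the half-window `H = [0, L/2]` (supremum of the image; `0` on an empty `H`). -/
def profileOddMax (L : ℝ) {N : ℕ} (u : Fin N → ℝ) : ℝ :=
  sSup ((fun x => |profileOdd L u x|) '' Icc 0 (L / 2))

/-- PROVED: `|θ_u(x)| ≤ profileOddMax` on `H`. [folklore] -/
theorem abs_profileOdd_le_profileOddMax (L : ℝ) {N : ℕ} (u : Fin N → ℝ) {x : ℝ} (hx : x ∈ Icc 0 (L / 2)) :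
    |profileOdd L u x| ≤ profileOddMax L u := by
  have hc : Continuous fun x => |profileOdd L u x| := (continuous_profileOdd L u).abs
  exact le_csSup (isCompact_Icc.image_of_continuousOn hc.continuousOn).bddAbove (mem_image_of_mem _ hx)

/-- PROVED: `0 ≤ profileOddMax`. [folklore] -/
theorem profileOddMax_nonneg (L : ℝ) {N : ℕ} (u : Fin N → ℝ) : 0 ≤ profileOddMax L u := by
  by_cases h : (Icc (0 : ℝ) (L / 2)).Nonempty
  · obtain ⟨x, hx⟩ := h
    exact (abs_nonneg _).trans (abs_profileOdd_le_profileOddMax L u hx)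
  · rw [Set.not_nonempty_iff_eq_empty] at h
    simp [profileOddMax, h]

/-! ## §2 Raw and floored one-signedness on `H` -/

/-- RAW odd one-signedness: one sign on the half-window `H = [0, L/2]` (schema `theta_sign_changes_odd = []`). -/
def OneSignedOdd (L : ℝ) {N : ℕ} (u : Fin N → ℝ) : Prop :=
  (∀ x ∈ Icc 0 (L / 2), 0 ≤ profileOdd L u x) ∨ (∀ x ∈ Icc 0 (L / 2), profileOdd L u x ≤ 0)

/-- FULL-WINDOW one-signedness of the odd profile (for contrast only; never a served reading). -/
def OneSignedOddFull (L : ℝ) {N : ℕ} (u : Fin N → ℝ) : Prop :=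
  (∀ x ∈ Icc (-(L / 2)) (L / 2), 0 ≤ profileOdd L u x) ∨ (∀ x ∈ Icc (-(L / 2)) (L / 2), profileOdd L u x ≤ 0)

/-- PROVED (why `H`): by antisymmetry an odd profile is one-signed on the FULL window iff it vanishes on `H`
(hence everywhere on the window) — the full-window reading carries no information beyond `θ ≡ 0`. [folklore] -/
theorem oneSignedOddFull_iff (L : ℝ) {N : ℕ} (u : Fin N → ℝ) :
    OneSignedOddFull L u ↔ ∀ x ∈ Icc 0 (L / 2), profileOdd L u x = 0 := by
  constructor
  · intro h x hx
    have hxw : x ∈ Icc (-(L / 2)) (L / 2) := ⟨by linarith [hx.1, hx.2], hx.2⟩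
    have hnxw : -x ∈ Icc (-(L / 2)) (L / 2) := ⟨by linarith [hx.2], by linarith [hx.1, hx.2]⟩
    rcases h with h | h
    · have h1 := h x hxw
      have h2 := h (-x) hnxw
      rw [profileOdd_neg] at h2
      linarith
    · have h1 := h x hxw
      have h2 := h (-x) hnxw
      rw [profileOdd_neg] at h2
      linarith
  · intro h
    refine Or.inl fun x hx => ?_
    by_cases hx0 : 0 ≤ x
    · rw [h x ⟨hx0, hx.2⟩]
    · have hnx : -x ∈ Icc 0 (L / 2) := ⟨by linarith, by linarith [hx.1]⟩
      have := h (-x) hnx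
      rw [profileOdd_neg] at this
      linarith

/-- **TYPED — THE `φ`-FLOORED ODD ONE-SIGNEDNESS on `H`** (loader rule, orientation-free: not both a value above
`φ·max_H|θ_u|` and a value below `−φ·max_H|θ_u|`). -/
def FloorOneSignedOdd (L φ : ℝ) {N : ℕ} (u : Fin N → ℝ) : Prop :=
  (∀ x ∈ Icc 0 (L / 2), -(φ * profileOddMax L u) ≤ profileOdd L u x) ∨
    (∀ x ∈ Icc 0 (L / 2), profileOdd L u x ≤ φ * profileOddMax L u)

/-- PROVED: at `φ = 0` the floored odd reader IS the raw odd reader. [folklore] -/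
theorem floorOneSignedOdd_zero_iff (L : ℝ) {N : ℕ} (u : Fin N → ℝ) :
    FloorOneSignedOdd L 0 u ↔ OneSignedOdd L u := by
  simp [FloorOneSignedOdd, OneSignedOdd]

/-- PROVED: the floored odd reader is MONOTONE in the floor. [folklore] -/
theorem FloorOneSignedOdd.mono {L φ φ' : ℝ} {N : ℕ} {u : Fin N → ℝ} (h : FloorOneSignedOdd L φ u) (hle : φ ≤ φ') :
    FloorOneSignedOdd L φ' u := by
  have hM := profileOddMax_nonneg L u
  have hφ : φ * profileOddMax L u ≤ φ' * profileOddMax L u := mul_le_mul_of_nonneg_right hle hM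
  rcases h with h | h
  · exact Or.inl fun x hx => by linarith [h x hx]
  · exact Or.inr fun x hx => (h x hx).trans hφ

/-- PROVED: raw odd one-signed ⇒ `φ`-floor odd one-signed for every `φ ≥ 0`. [folklore] -/
theorem OneSignedOdd.floorOneSignedOdd {L φ : ℝ} {N : ℕ} {u : Fin N → ℝ} (h : OneSignedOdd L u) (hφ : 0 ≤ φ) :
    FloorOneSignedOdd L φ u :=
  ((floorOneSignedOdd_zero_iff L u).2 h).mono hφ

/-- PROVED: at `φ ≥ 1` the floored odd reader is VACUOUS. [folklore] -/
theorem floorOneSignedOdd_of_one_le {L φ : ℝ} {N : ℕ} (u : Fin N → ℝ) (hφ : 1 ≤ φ) : FloorOneSignedOdd L φ u := by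
  refine Or.inr fun x hx => ?_
  have h1 := abs_profileOdd_le_profileOddMax L u hx
  have hM := profileOddMax_nonneg L u
  calc profileOdd L u x ≤ |profileOdd L u x| := le_abs_self _
    _ ≤ 1 * profileOddMax L u := by rw [one_mul]; exact h1
    _ ≤ φ * profileOddMax L u := mul_le_mul_of_nonneg_right hφ hM

/-! ## §3 The odd-sector readers on the cell's `Datum` (odd block read off the even block) -/

/-- The single-window criterion "some bottom vector of the ODD block at `win` has a raw one-signed profile on `H`"
(schema `n_theta_sign_changes_odd_raw = 0`). -/
def oddOneSignedAt (win : Window) : Set Datum :=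
  {d | ∃ u, IsBottomVector (oddDatum d win) u ∧ OneSignedOdd (2 * win.a) u}

/-- **TYPED — `FloorNodelessOddAt φ`** (the odd binder of A88 add. 2 (δ) / A119 (2)(b)): "some bottom vector of the odd
block `oddDatum d win` has a `φ`-floor one-signed profile on `H`" (schema `n_theta_sign_changes_odd = 0`, floor `φ = 1e-20`). -/
def floorNodelessOddAt (φ : ℝ) (win : Window) : Set Datum :=
  {d | ∃ u, IsBottomVector (oddDatum d win) u ∧ FloorOneSignedOdd (2 * win.a) φ u}

/-- PROVED: `floorNodelessOddAt 0 = oddOneSignedAt` (the raw odd reader). [folklore] -/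
theorem floorNodelessOddAt_zero (win : Window) : floorNodelessOddAt 0 win = oddOneSignedAt win := by
  ext d
  simp only [floorNodelessOddAt, oddOneSignedAt, mem_setOf_eq, floorOneSignedOdd_zero_iff]

/-- PROVED: the raw odd reader implies every floored odd reader (`φ ≥ 0`). [folklore] -/
theorem oddOneSignedAt_subset_floorNodelessOddAt {φ : ℝ} (hφ : 0 ≤ φ) (win : Window) :
    oddOneSignedAt win ⊆ floorNodelessOddAt φ win := by
  rintro d ⟨u, hu, h⟩
  exact ⟨u, hu, h.floorOneSignedOdd hφ⟩

/-- PROVED: monotone in the floor. [folklore] -/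
theorem floorNodelessOddAt_mono {φ φ' : ℝ} (hle : φ ≤ φ') (win : Window) :
    floorNodelessOddAt φ win ⊆ floorNodelessOddAt φ' win := by
  rintro d ⟨u, hu, h⟩
  exact ⟨u, hu, h.mono hle⟩

/-- PROVED: the floored odd reader is a single-window reader OF THE EVEN DATUM (`oddDatum d win = oddOfEven (d win)`) —
FINITELY DETERMINED for every floor, hence inside the locality barrier W1 (`not_separates_of_finitelyDetermined`). [folklore] -/
theorem finitelyDetermined_floorNodelessOddAt (φ : ℝ) (win : Window) :
    FinitelyDetermined (floorNodelessOddAt φ win) :=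
  finitelyDetermined_of_window win fun M => ∃ u, IsBottomVector (oddOfEven M) u ∧ FloorOneSignedOdd (2 * win.a) φ u

/-- PROVED: likewise for the raw odd reader. [folklore] -/
theorem finitelyDetermined_oddOneSignedAt (win : Window) : FinitelyDetermined (oddOneSignedAt win) := by
  rw [← floorNodelessOddAt_zero]
  exact finitelyDetermined_floorNodelessOddAt 0 win

/-! ## §4 The `eo` cell's two-parity handle -/

/-- **TYPED — the `eo` cell's handle**: both ground profiles `φ`-floor nodeless at `win` (even on the window, odd on `H`).
-/
def floorNodelessEOAt (φ : ℝ) (win : Window) : Set Datum := floorNodelessAt φ win ∩ floorNodelessOddAt φ win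

/-- PROVED: monotone in the floor. [folklore] -/
theorem floorNodelessEOAt_mono {φ φ' : ℝ} (hle : φ ≤ φ') (win : Window) :
    floorNodelessEOAt φ win ⊆ floorNodelessEOAt φ' win :=
  Set.inter_subset_inter (floorNodelessAt_mono hle win) (floorNodelessOddAt_mono hle win)

/-- PROVED: the two-parity handle is a single-window reader of the even datum — FINITELY DETERMINED (inside W1).
[folklore] -/
theorem finitelyDetermined_floorNodelessEOAt (φ : ℝ) (win : Window) : FinitelyDetermined (floorNodelessEOAt φ win) :=
  finitelyDetermined_of_window win fun M =>
    (∃ u, IsBottomVector M u ∧ FloorOneSigned (2 * win.a) φ u) ∧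
      ∃ u, IsBottomVector (oddOfEven M) u ∧ FloorOneSignedOdd (2 * win.a) φ u

end Summit.RiemannHypothesis.RiemannHypothesis.Theorems.PfPersistence

end
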